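import Literature.MathematicalPhysics.QuantumLattice.EmeryThreeBandBlock2x2RayleighOracle
import Literature.MathematicalPhysics.QuantumLattice.HubbardOpenBoxFastParity
import HarnessLib

/-!
# The `Cu₄O₈` atom-class oracles with the word-parallel sign (fast exact Rayleigh traces)

Topic `MathematicalPhysics/QuantumLattice`, family `hubbard`. `EmeryThreeBandBlock2x2RayleighOracle` makes the fourteen
atom-class traces of a sparse coded cluster vector on the open `Cu₄O₈` block kernel-computable (`cu4o8Cluster a`); measured,
one four-bond class costs ≈ 90 s of kernel time on a 4356-key vector, half of it in the bit-by-bit Jordan–Wigner sign and a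
quarter in the (empty) diagonal loops of the bond classes. This file swaps in the oracles of `HubbardOpenBoxFastParity`:
**`cu4o8ClusterF a`** = the pure-hopping oracle `bondClusterF` with the xor-folding sign for the bond classes `a < 8`
(their repulsion / site-energy tables vanish: `cu4o8V_eq_zero`, `cu4o8M_eq_zero`) and the diagonal-only `cu4o8Cluster a` for
the on-site classes; **`cu4o8ClusterF_models`**, and the same packaged forms as before with the fast oracle:
**`re_rayleigh_cu4o8TreeF`**, **`emeryEnergyDensity_le_of_cu4o8TreeF`**, **`cu4o8TreeF_traces`** (the orthonormality
form `cu4o8Tree_orthonormal` is oracle-free and is reused as is).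

Everything is proved; no named fact; nothing numerical is asserted here.

## References

* V. J. Emery, Phys. Rev. Lett. 58 (1987) 2794, eq. (1). [cite: Emery1987, eq. (1)]
* E. Pavarini et al., Phys. Rev. Lett. 87 (2001) 047003, eq. (1). [cite: PavariniEtAl2001, eq. (1)]
* D. Ruelle, *Statistical Mechanics: Rigorous Results* (1969), §3.3. [cite: Ruelle1969, §3.3]
* H. Q. Lin, J. E. Gubernatis, Comput. Phys. 7 (1993) 400, §II. [cite: LinGubernatis1993, §II]
-/

noncomputable section

open scoped ComplexOrder BigOperators
open Finset

namespace Literature.MathematicalPhysics.QuantumLattice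

open Matrix OccupationCode OccupationCode.CoefTree ClusterLowerBound InfVolFermionState

/-! ### §1 The bond classes carry no diagonal -/

/-- The repulsion site lists of the bond classes are empty (kernel-decided). [cite: PavariniEtAl2001, eq. (1)] -/
theorem cu4o8USites_eq_nil (a : Fin 14) (h : a.1 < 8) : cu4o8USites a = [] := by
  revert h a; decide

/-- The site-energy site lists of the bond classes are empty (kernel-decided). [cite: PavariniEtAl2001, eq. (1)] -/
theorem cu4o8EpsSites_eq_nil (a : Fin 14) (h : a.1 < 8) : cu4o8EpsSites a = [] := by
  revert h a; decide

/-- The repulsion table of a bond class vanishes. [cite: PavariniEtAl2001, eq. (1)] -/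
theorem cu4o8V_eq_zero (a : Fin 14) (h : a.1 < 8) : cu4o8V a = fun _ => 0 := by
  funext P; rw [cu4o8V, cu4o8USites_eq_nil a h]; simp

/-- The site-energy table of a bond class vanishes. [cite: PavariniEtAl2001, eq. (1)] -/
theorem cu4o8M_eq_zero (a : Fin 14) (h : a.1 < 8) : cu4o8M a = fun _ => 0 := by
  funext P; rw [cu4o8M, cu4o8EpsSites_eq_nil a h]; simp

/-- The hop lists use orbital ranks `≤ 64` (kernel-decided). [cite: LinGubernatis1993, §II] -/
theorem cu4o8Orbs_le64 (a : Fin 14) : orbsLe64 (cu4o8Orbs a) = true := by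
  revert a; decide +kernel

/-! ### §2 The fast oracles -/

/-- **THE FAST CODED CLUSTER ORACLE OF ATOM CLASS `a`**: pure hopping with the word-parallel sign for the bond classes,
diagonal-only for the on-site classes. [cite: LinGubernatis1993, §II] [cite: PavariniEtAl2001, eq. (1)] -/
def cu4o8ClusterF (a : Fin 14) : CodedCluster :=
  if a.1 < 8 then bondClusterF (cu4o8Orbs a) (hzBoundW (1 * 12) (cu4o8W a) (fun _ => 0) (fun _ => 0)) else cu4o8Cluster a

/-- **SEMANTICS**: `cu4o8ClusterF a` models `h^G_a` with `Q = 1` (the coded entry function is the one of `cu4o8Cluster a` up to the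
vanishing tables). [cite: LinGubernatis1993, §II] [cite: PavariniEtAl2001, eq. (1)] -/
theorem cu4o8ClusterF_models (a : Fin 14) :
    ∃ hz : ℕ → ℕ → ℤ, (cu4o8ClusterF a).Models 1 12 hz 1 (hubbardOpenBoxGP 1 12 (cu4o8Tau a) (cu4o8Ups a) (cu4o8Nu a)) := by
  unfold cu4o8ClusterF
  split_ifs with h
  · refine ⟨hzIntGP 1 12 (cu4o8W a) (fun _ => 0) (fun _ => 0), ?_⟩
    rw [cu4o8Tau_eq, cu4o8Ups_eq, cu4o8Nu_eq, cu4o8V_eq_zero a h, cu4o8M_eq_zero a h]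
    exact bondClusterF_models (cu4o8W a) (cu4o8W_symm a) (cu4o8Adj a) (cu4o8W_off a) (cu4o8W_diag a) 1 (cu4o8Orbs_eq a)
      (cu4o8Orbs_le64 a)
  · exact ⟨_, cu4o8Cluster_models a⟩

/-! ### §3 Exact traces with the fast oracles -/

/-- **THE EXACT RAYLEIGH TRACE (fast oracle)**: `Re⟨T.unit, h^G_a T.unit⟩ = T.sApp (cu4o8ClusterF a) / T.nn`.
[cite: Ruelle1969, §3.3] [cite: LinGubernatis1993, §II] -/
theorem re_rayleigh_cu4o8TreeF {T : CoefTree} (hB : T.isBST 0 (4 ^ (1 * 12)) = true) (hnn : 0 < T.nn) (a : Fin 14) :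
    (star (T.unit : Fock (Orb (Fin 1 ×ₗ Fin 12))) ⬝ᵥ
        (hubbardOpenBoxGP 1 12 (cu4o8Tau a) (cu4o8Ups a) (cu4o8Nu a) *ᵥ T.unit)).re =
      (T.sApp (cu4o8ClusterF a) : ℝ) / (T.nn : ℝ) := by
  obtain ⟨hz, hM⟩ := cu4o8ClusterF_models a
  rw [re_star_unit_dotProduct_mulVec_unit hM hB hnn, Nat.cast_one, one_mul]

/-- **THE THREE-BAND CAP FROM ONE CHECKED TREE (fast oracle)**: as `emeryEnergyDensity_le_of_cu4o8Tree` with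
`S a = T.sApp (cu4o8ClusterF a)`. [cite: Ruelle1969, §3.3] [cite: Emery1987, eq. (1)] -/
theorem emeryEnergyDensity_le_of_cu4o8TreeF (θ : Fin 14 → ℝ) {N : ℕ} {T : CoefTree} (hB : T.isBST 0 (4 ^ (1 * 12)) = true)
    (hnn : 0 < T.nn) (hN : T.allKeys (fun m => decide (OccupationCode.upCount (1 * 12) m + OccupationCode.dnCount (1 * 12) m = N)) = true)
    {S : Fin 14 → ℤ} (hS : ∀ a, T.sApp (cu4o8ClusterF a) = S a) :
    emeryEnergyDensity θ ((N : ℝ) / 16) ≤ (1 / 16) * ∑ a : Fin 14, θ a * ((S a : ℝ) / (T.nn : ℝ)) := by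
  have h := emeryEnergyDensity_le_block2x2_rayleigh θ (isNParticle_unit (a := 1) (b := 12) hN)
    (star_unit_dotProduct_unit hB hnn)
  refine h.trans (le_of_eq ?_)
  congr 1
  refine Finset.sum_congr rfl fun a _ => ?_
  rw [re_rayleigh_cu4o8TreeF hB hnn a, hS a]

/-- **THE TRACE HYPOTHESIS `hT` OF THE RAYLEIGH-FAMILY FLOOR (fast oracle)**. [cite: Ruelle1969, §3.3] -/
theorem cu4o8TreeF_traces {ι : Type*} (T : ι → CoefTree) (hB : ∀ i, (T i).isBST 0 (4 ^ (1 * 12)) = true)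
    (hnn : ∀ i, 0 < (T i).nn) {S : ι → Fin 14 → ℤ} (hS : ∀ i a, (T i).sApp (cu4o8ClusterF a) = S i a) (i : ι) (a : Fin 14) :
    (star ((T i).unit : Fock (Orb (Fin 1 ×ₗ Fin 12))) ⬝ᵥ
        (hubbardOpenBoxGP 1 12 (cu4o8Tau a) (cu4o8Ups a) (cu4o8Nu a) *ᵥ (T i).unit)).re =
      (S i a : ℝ) / ((T i).nn : ℝ) := by
  rw [re_rayleigh_cu4o8TreeF (hB i) (hnn i) a, hS i a]

end Literature.MathematicalPhysics.QuantumLattice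

end
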